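import Literature.NumberTheory.EllipticCurves.WeierstrassZetaDivisionValues
import Literature.NumberTheory.EllipticCurves.WeierstrassPDivisionValuesAtImInfty
import Literature.NumberTheory.EllipticCurves.EisensteinWeightOneLatticeLimit
import Mathlib.Analysis.SpecialFunctions.Trigonometric.Cotangent
import HarnessLib

/-!
# Rows of the corrected `ζ`-division value `Z_v`: cotangent evaluation

Topic `Literature/NumberTheory/EllipticCurves`; namespace
`Literature.NumberTheory.EllipticCurves.ModularForms`.  Definitions with bodies (`zetaPairSummand`,
`zetaRow`) and theorems; no named fact.

For the corrected `ζ`-division value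
`Z_v(τ) = ζ(z_v; Λ_τ) - z_v G₂(τ) + 2πi c_v/N`, `z_v = (c_v τ + d_v)/N`
(`eisensteinOneDiv`, `WeierstrassZetaDivisionValues`) both lattice sums are summed by ROWS
`x₀ = m`: `ζ(z_v; Λ_τ) = ∑_m ρ_m` (Fubini for the absolutely convergent double sum,
`hasSum_rows_weierstrassZetaDiv`) and `G₂ = ∑_m B_m`, `B_m = ∑_n (mτ+n)⁻²` (Mathlib's `G2` is the
symmetric sum of the rows `e2Summand m`, and the family of rows is absolutely summable,
`hasSum_e2Summand_G2`).  In the difference the terms `z_v (mτ + n)⁻²` cancel INSIDE each row,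
leaving the absolutely convergent **pair rows**

  `T_m(τ) = ∑_{n ∈ ℤ} ( 1/(w_m - n) + 1/(mτ + n) )`,  `w_m = z_v - mτ = (c_m τ + d_v)/N`,
  `c_m = c_v - Nm`                                                   (`zetaRow`, `zetaPairSummand`)

(`tsum_zetaPairSummand_eq`: `T_m = ρ_m - z_v B_m`; the general term is `z_v/((w_m - n)(mτ + n))`,
so no conditionally convergent series occurs), and

  **`Z_v(τ) = 2πi c_v/N + ∑_{m ∈ ℤ} T_m(τ)`**                      (`hasSum_zetaRow_eisensteinOneDiv`).

Pairing `n ↔ -n` (Mathlib `HasSum.nat_add_neg`) and the partial fractions of the cotangent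
(Mathlib `cot_series_rep'`) evaluate every row in closed form:

  **`T_m = π cot(π w_m) + [m ≠ 0] π cot(π m τ)`**                    (`zetaRow_eq_cot`)

whenever `w_m ∉ ℤ` (automatic unless `v ≡ 0 (mod N)`).  The `q_N`-expansions of these cotangents,
the constant term of `Z_v` at `i∞` (`2πi B₁(c_v/N)` for `0 < c_v < N`, `π cot(π d_v/N)` for
`c_v = 0`), boundedness and holomorphy are the next file.  This is the classical computation of
the Fourier expansion of the weight-one Eisenstein series / division values of `ζ`
(Hecke 1927, §2; Schoeneberg, *Elliptic Modular Functions*, VII §2 (14) and VIII §1;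
Diamond–Shurman §4.8), organised so that only absolutely convergent rows are used.

## References

* E. Hecke, *Theorie der Eisensteinschen Reihen höherer Stufe…*, Abh. Math. Sem. Hamburg 5 (1927),
  §2.
* B. Schoeneberg, *Elliptic Modular Functions*, Springer (1974), Ch. VII §2, Ch. VIII §1.
* F. Diamond, J. Shurman, *A First Course in Modular Forms*, GTM 228 (2005), §4.8.
  [DiamondShurman2005]
-/

noncomputable section

open UpperHalfPlane hiding I
open EisensteinSeries Complex Filter SummationFilter

open scoped Real MatrixGroups Topology

namespace Literature.NumberTheory.EllipticCurves.ModularForms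

variable {N : ℕ} [NeZero N]

/-! ### The pair summand `1/(w_m - n) + 1/(mτ + n)` -/

/-- The **pair summand** `N e₁(c_v - Nm, d_v - Nn) + e₁(m, n) = 1/(w_m - n) + 1/(mτ + n)` of the
`m`-th row of `Z_v` (`w_m = ((c_v - Nm)τ + d_v)/N`). [folklore] -/
def zetaPairSummand (N : ℕ) (v : Fin 2 → ℤ) (τ : ℍ) (m n : ℤ) : ℂ :=
  (N : ℂ) * eisSummand 1 ![v 0 - N * m, v 1 - N * n] τ + eisSummand 1 ![m, n] τ

/-- The **pair row** `T_m(τ) = ∑_{n ∈ ℤ} (1/(w_m - n) + 1/(mτ + n))`. [folklore] -/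
def zetaRow (N : ℕ) (v : Fin 2 → ℤ) (τ : ℍ) (m : ℤ) : ℂ :=
  ∑' n : ℤ, zetaPairSummand N v τ m n

omit [NeZero N] in
/-- The lattice-sum summand of `ζ(z_v; Λ_τ)` at `x = (m, n)` is the pair summand plus
`z_v (mτ + n)⁻²`. [folklore] -/
theorem zetaDivSummand_vecTwo (v : Fin 2 → ℤ) (τ : ℍ) (m n : ℤ) :
    zetaDivSummand N v τ ![m, n] =
      zetaPairSummand N v τ m n + divPoint N v τ * eisSummand 2 ![m, n] τ := by
  have hv : v - (N : ℤ) • ![m, n] = ![v 0 - N * m, v 1 - N * n] := by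
    funext i
    fin_cases i <;> simp
  unfold zetaDivSummand zetaPairSummand
  rw [hv]

/-- The pair summand in closed form: `1/(w_m - n) + 1/(mτ + n)` with
`w_m = divPoint N (c_v - Nm, d_v) τ`. [folklore] -/
theorem zetaPairSummand_eq (v : Fin 2 → ℤ) (τ : ℍ) (m n : ℤ) :
    zetaPairSummand N v τ m n =
      1 / (divPoint N ![v 0 - N * m, v 1] τ - n) + 1 / ((m : ℂ) * τ + n) := by
  have hN' : (N : ℂ) ≠ 0 := by exact_mod_cast NeZero.ne N
  have h : divPoint N ![v 0 - N * m, v 1] τ - n =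
      ((((v 0 - N * m : ℤ)) : ℂ) * τ + ((v 1 - N * n : ℤ) : ℂ)) / N := by
    unfold divPoint
    simp only [Matrix.cons_val_zero, Matrix.cons_val_one, Matrix.cons_val_fin_one]
    push_cast
    field_simp
    ring
  rw [h]
  simp only [zetaPairSummand, eisSummand, Matrix.cons_val_zero, Matrix.cons_val_one,
    Matrix.cons_val_fin_one, _root_.zpow_neg, zpow_one]
  rw [one_div, one_div, inv_div, div_eq_mul_inv]

/-! ### Fubini for `ζ(z_v; Λ_τ)` and the rows of `G₂` -/

/-- The lattice sum of `ζ(z_v; Λ_τ)`, as a family on `ℤ × ℤ`, is summable. [folklore] -/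
theorem summable_zetaDivSummand_prod (v : Fin 2 → ℤ) (τ : ℍ) :
    Summable fun p : ℤ × ℤ ↦ zetaDivSummand N v τ ![p.1, p.2] := by
  have h := (finTwoArrowEquiv ℤ).symm.summable_iff.mpr (summable_zetaDivSummand (NeZero.ne N) v τ)
  refine h.congr fun p ↦ ?_
  rw [Function.comp_apply, finTwoArrowEquiv_symm_apply]

/-- Each row `n ↦ s_v(m, n)` of the lattice sum of `ζ(z_v; Λ_τ)` is summable. [folklore] -/
theorem summable_zetaDivSummand_row (v : Fin 2 → ℤ) (τ : ℍ) (m : ℤ) :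
    Summable fun n : ℤ ↦ zetaDivSummand N v τ ![m, n] :=
  (summable_zetaDivSummand_prod (N := N) v τ).prod_factor m

/-- **`ζ(z_v; Λ_τ) = ∑_{m ∈ ℤ} ρ_m`**, `ρ_m = ∑_n s_v(m, n)` (Fubini for the absolutely convergent
lattice sum, summed by rows). [cite: DiamondShurman2005, §4.8] -/
theorem hasSum_rows_weierstrassZetaDiv (v : Fin 2 → ℤ) (τ : ℍ) :
    HasSum (fun m : ℤ ↦ ∑' n : ℤ, zetaDivSummand N v τ ![m, n]) (weierstrassZetaDiv N v τ) := by
  have h' := summable_zetaDivSummand_prod (N := N) v τ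
  have hsum : ∑' p : ℤ × ℤ, zetaDivSummand N v τ ![p.1, p.2] = weierstrassZetaDiv N v τ := by
    unfold weierstrassZetaDiv
    rw [← (finTwoArrowEquiv ℤ).symm.tsum_eq]
    refine tsum_congr fun p ↦ ?_
    rw [finTwoArrowEquiv_symm_apply]
  rw [← hsum, h'.tsum_prod]
  exact h'.prod.hasSum

omit [NeZero N] in
/-- The rows `m ↦ e2Summand m τ = ∑_n (mτ + n)⁻²` of `G₂` form an absolutely summable family
(exponential decay in `|m|`; the conditional convergence of `G₂` is only in the order of the double
sum). [folklore] -/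
theorem summable_e2Summand_int (τ : ℍ) : Summable fun m : ℤ ↦ e2Summand m τ := by
  have h := (summable_ite_neg_e2Summand τ).neg.add
    (hasSum_ite_eq (0 : ℤ) (e2Summand 0 τ)).summable
  refine h.congr fun m ↦ ?_
  by_cases hm : m = 0
  · subst hm; simp
  · simp [hm]

omit [NeZero N] in
/-- **`G₂(τ) = ∑_{m ∈ ℤ} e2Summand m τ`** as an unconditional sum of its rows. [folklore] -/
theorem hasSum_e2Summand_G2 (τ : ℍ) : HasSum (fun m : ℤ ↦ e2Summand m τ) (G2 τ) := by
  have h := (summable_e2Summand_int τ).hasSum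
  have hG : G2 τ = ∑' m : ℤ, e2Summand m τ := by
    show ∑'[symmetricIcc ℤ] m, e2Summand m τ = _
    exact tsum_eq_of_summable_unconditional (summable_e2Summand_int τ)
  rwa [← hG] at h

/-! ### The pair rows -/

/-- Each pair row `n ↦ 1/(w_m - n) + 1/(mτ + n)` is (absolutely) summable: it is the difference of
the summable `ζ`-row and `z_v` times the summable row `(mτ + n)⁻²`. [folklore] -/
theorem summable_zetaPairSummand (v : Fin 2 → ℤ) (τ : ℍ) (m : ℤ) :
    Summable fun n : ℤ ↦ zetaPairSummand N v τ m n := by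
  have h := (summable_zetaDivSummand_row (N := N) v τ m).sub
    ((e2Summand_summable m τ).mul_left (divPoint N v τ))
  refine h.congr fun n ↦ ?_
  rw [zetaDivSummand_vecTwo]
  ring

/-- **`T_m = ρ_m - z_v e2Summand m τ`**: the pair row is the `ζ`-row minus `z_v` times the row of
`G₂`. [folklore] -/
theorem zetaRow_eq_sub (v : Fin 2 → ℤ) (τ : ℍ) (m : ℤ) :
    zetaRow N v τ m =
      ∑' n : ℤ, zetaDivSummand N v τ ![m, n] - divPoint N v τ * e2Summand m τ := by
  rw [e2Summand, ← tsum_mul_left, ← Summable.tsum_sub (summable_zetaDivSummand_row v τ m)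
    ((e2Summand_summable m τ).mul_left _)]
  refine tsum_congr fun n ↦ ?_
  rw [zetaDivSummand_vecTwo]
  ring

/-- The family of pair rows `m ↦ T_m` is summable. [folklore] -/
theorem summable_zetaRow (v : Fin 2 → ℤ) (τ : ℍ) : Summable fun m : ℤ ↦ zetaRow N v τ m := by
  have h := (hasSum_rows_weierstrassZetaDiv (N := N) v τ).summable.sub
    ((summable_e2Summand_int τ).mul_left (divPoint N v τ))
  refine h.congr fun m ↦ ?_
  rw [zetaRow_eq_sub]

/-- **`∑_m T_m = ζ(z_v; Λ_τ) - z_v G₂(τ)`.** [cite: DiamondShurman2005, §4.8] -/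
theorem hasSum_zetaRow (v : Fin 2 → ℤ) (τ : ℍ) :
    HasSum (fun m : ℤ ↦ zetaRow N v τ m)
      (weierstrassZetaDiv N v τ - divPoint N v τ * G2 τ) := by
  have h := (hasSum_rows_weierstrassZetaDiv (N := N) v τ).sub
    ((hasSum_e2Summand_G2 τ).mul_left (divPoint N v τ))
  refine h.congr_fun fun m ↦ ?_
  rw [zetaRow_eq_sub]

/-- **`Z_v(τ) = 2πi c_v/N + ∑_{m ∈ ℤ} T_m(τ)`.** [cite: DiamondShurman2005, §4.8] -/
theorem hasSum_zetaRow_eisensteinOneDiv (v : Fin 2 → ℤ) (τ : ℍ) :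
    HasSum (fun m : ℤ ↦ zetaRow N v τ m)
      (eisensteinOneDiv N v τ - 2 * π * I * (v 0 : ℂ) / N) := by
  have h := hasSum_zetaRow (N := N) v τ
  unfold eisensteinOneDiv
  convert h using 1
  ring

/-! ### Cotangent evaluation of the pair rows -/

/-- `w_m = ((c_v - Nm)τ + d_v)/N` is not an integer unless `c_v ≡ d_v ≡ 0 (mod N)`. [folklore] -/
theorem divPoint_row_mem_integerComplement (v : Fin 2 → ℤ) (τ : ℍ) (m : ℤ)
    (hv : ¬ ((N : ℤ) ∣ v 0 ∧ (N : ℤ) ∣ v 1)) :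
    divPoint N ![v 0 - N * m, v 1] τ ∈ Complex.integerComplement := by
  have hN' : (N : ℂ) ≠ 0 := by exact_mod_cast NeZero.ne N
  have hNr : (0 : ℝ) < N := Nat.cast_pos.mpr (NeZero.pos N)
  by_cases hc : v 0 - N * m = 0
  · -- real, but not an integer
    have hd : ¬ (N : ℤ) ∣ v 1 := fun h ↦ hv ⟨⟨m, by omega⟩, h⟩
    rw [Complex.mem_integerComplement_iff]
    rintro ⟨n, hn⟩
    apply hd
    refine ⟨n, ?_⟩
    have h : (n : ℂ) * N = (v 1 : ℂ) := by
      rw [hn]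
      unfold divPoint
      simp only [Matrix.cons_val_zero, Matrix.cons_val_one, Matrix.cons_val_fin_one, hc,
        Int.cast_zero, zero_mul, zero_add]
      field_simp
    exact_mod_cast (by rw [mul_comm] at h; exact_mod_cast h.symm : (v 1 : ℤ) = N * n)
  · refine mem_integerComplement_of_im_ne_zero ?_
    unfold divPoint
    rw [Complex.div_natCast_im]
    simp only [Matrix.cons_val_zero, Matrix.cons_val_one, Matrix.cons_val_fin_one, add_im,
      mul_im, intCast_re, intCast_im, zero_mul, add_zero, UpperHalfPlane.coe_im,
      UpperHalfPlane.coe_re]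
    refine div_ne_zero (mul_ne_zero ?_ τ.im_pos.ne') hNr.ne'
    exact_mod_cast hc

omit [NeZero N] in
/-- `mτ` is not an integer for `m ≠ 0`. [folklore] -/
theorem intCast_mul_mem_integerComplement (τ : ℍ) {m : ℤ} (hm : m ≠ 0) :
    (m : ℂ) * τ ∈ Complex.integerComplement := by
  refine mem_integerComplement_of_im_ne_zero ?_
  simp only [mul_im, intCast_re, intCast_im, zero_mul, add_zero, UpperHalfPlane.coe_im]
  exact mul_ne_zero (by exact_mod_cast hm) τ.im_pos.ne'

omit [NeZero N] in
/-- The partial fractions of the cotangent as a `HasSum`: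
`∑_{n ≥ 0} (1/(x - (n+1)) + 1/(x + (n+1))) = π cot(πx) - 1/x` for `x ∉ ℤ` (Mathlib
`cot_series_rep'`). [folklore] -/
theorem hasSum_cotTerm {x : ℂ} (hx : x ∈ Complex.integerComplement) :
    HasSum (fun n : ℕ ↦ 1 / (x - (n + 1)) + 1 / (x + (n + 1))) (π * Complex.cot (π * x) - 1 / x) := by
  have h := (summable_cotTerm hx).hasSum
  rwa [← cot_series_rep' hx] at h

omit [NeZero N] in
/-- The degenerate partial fractions at `x = 0`: `1/(0 - (n+1)) + 1/(0 + (n+1)) = 0`. [folklore] -/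
theorem hasSum_cotTerm_zero :
    HasSum (fun n : ℕ ↦ 1 / ((0 : ℂ) - (n + 1)) + 1 / ((0 : ℂ) + (n + 1))) 0 := by
  refine hasSum_zero.congr_fun fun n ↦ ?_
  rw [zero_sub, zero_add, one_div, one_div, inv_neg, neg_add_cancel]

/-- **Cotangent evaluation of the pair rows**: for `v ≢ 0 (mod N)`,
`T_m = π cot(π w_m) + [m ≠ 0] π cot(π m τ)`, `w_m = ((c_v - Nm)τ + d_v)/N` (pairing `n ↔ -n` in
the absolutely convergent row and Euler's partial fractions for both halves).
[cite: DiamondShurman2005, §4.8] -/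
theorem zetaRow_eq_cot (v : Fin 2 → ℤ) (τ : ℍ) (m : ℤ)
    (hv : ¬ ((N : ℤ) ∣ v 0 ∧ (N : ℤ) ∣ v 1)) :
    zetaRow N v τ m =
      π * Complex.cot (π * divPoint N ![v 0 - N * m, v 1] τ) +
        (if m = 0 then 0 else π * Complex.cot (π * ((m : ℂ) * τ))) := by
  set w : ℂ := divPoint N ![v 0 - N * m, v 1] τ with hw
  set u : ℂ := (m : ℂ) * τ with hu
  have hwZ : w ∈ Complex.integerComplement := divPoint_row_mem_integerComplement v τ m hv
  -- the pair row as a function on `ℤ`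
  set f : ℤ → ℂ := fun n ↦ zetaPairSummand N v τ m n with hf
  have hfn : ∀ n : ℤ, f n = 1 / (w - n) + 1 / (u + n) := fun n ↦ by
    rw [hf]
    exact zetaPairSummand_eq v τ m n
  have hT : HasSum f (zetaRow N v τ m) := (summable_zetaPairSummand v τ m).hasSum
  -- pairing `n ↔ -n`
  have hpair := hT.nat_add_neg
  -- split off the term `n = 0`
  rw [← hasSum_nat_add_iff' 1] at hpair
  simp only [Finset.range_one, Finset.sum_singleton, Nat.cast_zero, neg_zero] at hpair
  -- the tail: two cotangent series
  have htail : HasSum (fun n : ℕ ↦ f ((n + 1 : ℕ) : ℤ) + f (-((n + 1 : ℕ) : ℤ)))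
      ((π * Complex.cot (π * w) - 1 / w) +
        (if m = 0 then 0 else π * Complex.cot (π * u) - 1 / u)) := by
    have h1 := hasSum_cotTerm hwZ
    have h2 : HasSum (fun n : ℕ ↦ 1 / (u - (n + 1)) + 1 / (u + (n + 1)))
        (if m = 0 then 0 else π * Complex.cot (π * u) - 1 / u) := by
      by_cases hm : m = 0
      · rw [if_pos hm]
        have hu0 : u = 0 := by rw [hu, hm]; simp
        rw [hu0]
        exact hasSum_cotTerm_zero
      · rw [if_neg hm]
        exact hasSum_cotTerm (intCast_mul_mem_integerComplement τ hm)
    refine (h1.add h2).congr_fun fun n ↦ ?_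
    rw [hfn, hfn]
    push_cast
    ring
  have hlim := hpair.unique htail
  -- `f 0 = 1/w + 1/u` (with `1/u = 0` when `m = 0`)
  have hf0 : f 0 = 1 / w + 1 / u := by rw [hfn]; simp
  by_cases hm : m = 0
  · have hu0 : u = 0 := by rw [hu, hm]; simp
    rw [if_pos hm] at hlim ⊢
    rw [hf0, hu0] at hlim
    have : zetaRow N v τ m = π * Complex.cot (π * w) := by
      have h' := hlim
      simp only [div_zero, add_zero] at h'
      linear_combination h'
    rw [this, add_zero]
  · rw [if_neg hm] at hlim ⊢
    rw [hf0] at hlim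
    linear_combination hlim

end Literature.NumberTheory.EllipticCurves.ModularForms
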